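import Literature.MathematicalPhysics.QuantumManyBody.PeriodicBoseGasLocalization
import Literature.Analysis.FluidPDE.BiotSavartNewtonKernel
import Literature.Analysis.FluidPDE.DivCurlLiouvilleBounded
import Literature.Analysis.FluidPDE.RieszKernelBounds
import HarnessLib

/-!
# The scattering solution is the Newtonian potential of `g/2`: `ω = (8π)⁻¹∫g(y)/|x-y|dy` a.e.

Topic `Literature/MathematicalPhysics/QuantumManyBody` (provefact
`Literature.MathematicalPhysics.QuantumManyBody.BoseGas.Fournais2020_condensation`, layer `Fournais2020_lemma24`,
input `Fournais2020_eq242` = [Fournais2020, (2.42) with (A.6)]). The last step of (2.42),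
"`(1 + C(R/ℓ)²)(2π)⁻³∫ĝ²/(2p²) = (1 + C(R/ℓ)²)∫gω`, where we used (A.6)", rests on the Fourier
representation `ω̂(k) = ĝ(k)/(2k²)` of the scattering solution (`-Δω = g/2`, `ω → 0` at
infinity), i.e. in position space `ω = (8π)⁻¹ g * |x|⁻¹`. For the scattering solutions of the tree
(`IsScatteringSolution`: the weak equation (A.1) against `C_c^∞` test functions, `0 ≤ ω ≤ 1`,
`ω = a/|x|` beyond the range, for a finite-range `v` with `∫v < ∞`) this file proves that
representation almost everywhere — a uniqueness theorem for the distributional Poisson equation: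

* `exists_setLIntegral_inv_norm_sub_le`, `exists_setLIntegral_potential_le`,
  `locallyIntegrable_potential` — `∫_{B(c,ρ)}dx/|x-y| ≤ K(ρ)` uniformly, whence the Newtonian
  potential `x ↦ ∫g(y)/|x-y|dy` of an integrable `g ≥ 0` is a.e. finite and locally integrable,
  with `∫_{B(c,ρ)}|∫g(y)/|x-y|dy|dx ≤ K(ρ)‖g‖₁` uniformly in the centre;
* `integral_potential_mul_laplacian` — it solves Poisson's equation weakly,
  `∫(∫g(y)/|x-y|dy)Δφ(x)dx = -4π∫gφ` (Fubini and Green's representation formula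
  `∫Γ(y-x)Δφ(x)dx = φ(y)` of the tree, `FluidPDE/BiotSavartNewtonKernel`);
* `integral_omega_mul_laplacian` — `∫ωΔφ = -½∫gφ`, `g = v(1-ω)` ((A.1) and `∫Δφ = 0`);
* `IsScatteringSolution.ae_eq_potential` — **`ω = (8π)⁻¹∫g(y)/|x-y|dy` a.e.**: the difference `h`
  is locally integrable and weakly harmonic on `ℝ³`; its mollifications `ψₖ ⋆ h` are harmonic
  (`FluidPDE.laplacian_convolution_lsmul`) and bounded (the potential has uniformly bounded means over
  balls of fixed radius), hence constant (Liouville, `HarmonicOnNhd.apply_eq_apply_of_abs_le`); they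
  converge to `h` a.e. (`FunctionSpaces.ae_tendsto_normed_convolution`), so `h = c` a.e.; and `c = 0`
  because `∫_{B(x₀,1)}|h| ≤ |B₁|(a + ‖g‖₁/(8π))/(|x₀| - 1 - R) → 0` as `|x₀| → ∞` (`ω = a/|x|` off
  the support, (A.3)).

No new definitions.

## References

* [Fournais2020] S. Fournais, *Length scales for BEC in the dilute Bose gas*, arXiv:2011.00309,
  EMS Ser. Congr. Rep. 18 (2021), doi:10.4171/ecr/18-1/7: App. A (A.1)–(A.6), (2.42).
* [GilbargTrudinger2001] D. Gilbarg, N. S. Trudinger, *Elliptic partial differential equations of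
  second order*, Springer 2001: (2.17) (Green's representation), Thm. 2.1 (mean value / Liouville).
* [LSSY2005] E. H. Lieb, R. Seiringer, J. P. Solovej, J. Yngvason, *The Mathematics of the Bose Gas
  and its Condensation*, Birkhäuser 2005: App. C (the scattering solution).
-/

noncomputable section

open MeasureTheory Set Filter Metric Topology TopologicalSpace
open scoped ENNReal NNReal RealInnerProductSpace Laplacian Convolution

namespace Literature.MathematicalPhysics.QuantumManyBody.BoseGas

open Literature.Analysis

/-! ### The Newtonian kernel `|x - y|⁻¹` on balls -/

section Kernel

/-- `∫_{B(c,ρ)} dx/|x - y| ≤ K(ρ) < ∞` uniformly in the centre `c` and the pole `y`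
(`≤ ∫_{B(0,ρ)}|x|⁻¹dx + ρ⁻¹|B_ρ|`). [folklore] -/
theorem exists_setLIntegral_inv_norm_sub_le (ρ : ℝ) :
    ∃ K : ℝ≥0∞, K ≠ ⊤ ∧ ∀ c y : Space, ∫⁻ x in ball c ρ, ENNReal.ofReal (‖x - y‖⁻¹) ≤ K := by
  set k : Space → ℝ≥0∞ := fun x => ENNReal.ofReal (‖x‖⁻¹) with hk
  have hkm : Measurable k := (measurable_norm.inv).ennreal_ofReal
  have hA : ∫⁻ x in ball (0 : Space) ρ, k x < ⊤ := by
    have h := FluidPDE.RieszKernel.lintegral_ball_powKer_lt_top (s := 1) (by norm_num) ρ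
    refine lt_of_le_of_lt (le_of_eq (setLIntegral_congr_fun measurableSet_ball fun x _ => ?_)) h
    simp only [hk, FluidPDE.RieszKernel.powKer_apply, Real.rpow_neg_one]
  have hvol : volume (ball (0 : Space) ρ) < ⊤ := measure_ball_lt_top
  refine ⟨(∫⁻ x in ball (0 : Space) ρ, k x) + ENNReal.ofReal ρ⁻¹ * volume (ball (0 : Space) ρ),
    ENNReal.add_ne_top.2 ⟨hA.ne, ENNReal.mul_ne_top ENNReal.ofReal_ne_top hvol.ne⟩, fun c y => ?_⟩
  -- translate the pole to the origin
  have htr : ∫⁻ x in ball c ρ, ENNReal.ofReal (‖x - y‖⁻¹) = ∫⁻ x in ball (c - y) ρ, k x := by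
    rw [← lintegral_indicator measurableSet_ball, ← lintegral_indicator measurableSet_ball,
      ← lintegral_sub_right_eq_self (μ := (volume : Measure Space)) ((ball (c - y) ρ).indicator k) y]
    refine lintegral_congr fun x => ?_
    simp only [indicator, mem_ball, dist_eq_norm, hk]
    have : ‖x - y - (c - y)‖ = ‖x - c‖ := by congr 1; abel
    rw [this]
  rw [htr]
  -- split the translated ball into its parts inside and outside `B(0, ρ)`
  have hsplit : ball (c - y) ρ ⊆ ball (0 : Space) ρ ∪ (ball (c - y) ρ \ ball 0 ρ) := by
    intro x hx
    by_cases h : x ∈ ball (0 : Space) ρ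
    · exact Or.inl h
    · exact Or.inr ⟨hx, h⟩
  calc ∫⁻ x in ball (c - y) ρ, k x ≤ ∫⁻ x in ball (0 : Space) ρ ∪ (ball (c - y) ρ \ ball 0 ρ), k x :=
        lintegral_mono_set hsplit
    _ ≤ (∫⁻ x in ball (0 : Space) ρ, k x) + ∫⁻ x in ball (c - y) ρ \ ball 0 ρ, k x := lintegral_union_le _ _ _
    _ ≤ (∫⁻ x in ball (0 : Space) ρ, k x) + ∫⁻ x in ball (c - y) ρ \ ball 0 ρ, ENNReal.ofReal ρ⁻¹ := by
        gcongr 1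
        refine setLIntegral_mono measurable_const fun x hx => ?_
        have hx' : ρ ≤ ‖x‖ := by
          have := hx.2
          rw [mem_ball_zero_iff, not_lt] at this
          exact this
        have hρ : 0 < ρ := by
          have h1 := hx.1
          rw [mem_ball] at h1
          exact lt_of_le_of_lt dist_nonneg h1
        exact ENNReal.ofReal_le_ofReal (by rw [inv_le_inv₀ (lt_of_lt_of_le hρ hx') hρ]; exact hx')
    _ ≤ (∫⁻ x in ball (0 : Space) ρ, k x) + ENNReal.ofReal ρ⁻¹ * volume (ball (0 : Space) ρ) := by
        rw [setLIntegral_const]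
        gcongr 1
        calc ENNReal.ofReal ρ⁻¹ * volume (ball (c - y) ρ \ ball 0 ρ) ≤ ENNReal.ofReal ρ⁻¹ * volume (ball (c - y) ρ) := by
              gcongr; exact fun x hx => hx.1
          _ = ENNReal.ofReal ρ⁻¹ * volume (ball (0 : Space) ρ) := by
              rw [Measure.addHaar_ball_center]

/-- `(x, y) ↦ |x - y|⁻¹` is measurable. [folklore] -/
theorem measurable_inv_norm_sub : Measurable fun q : Space × Space => ‖q.1 - q.2‖⁻¹ :=
  (measurable_fst.sub measurable_snd).norm.inv

end Kernel

/-! ### The Newtonian potential of a non-negative integrable density -/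

section Potential

variable {g : Space → ℝ}

/-- **Local integrability of the potential**, quantitatively: `∫_{B(c,ρ)}∫ g(y)/|x-y| dy dx ≤ K(ρ)∫g`
uniformly in the centre. [folklore] -/
theorem exists_setLIntegral_potential_le (hgm : Measurable g) (hg0 : ∀ y, 0 ≤ g y) (ρ : ℝ) :
    ∃ K : ℝ≥0∞, K ≠ ⊤ ∧ ∀ c : Space,
      ∫⁻ x in ball c ρ, ∫⁻ y, ENNReal.ofReal (g y * ‖x - y‖⁻¹) ≤ K * ∫⁻ y, ENNReal.ofReal (g y) := by
  obtain ⟨K, hK, hKb⟩ := exists_setLIntegral_inv_norm_sub_le ρ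
  refine ⟨K, hK, fun c => ?_⟩
  have hm : Measurable fun q : Space × Space => ENNReal.ofReal (g q.2 * ‖q.1 - q.2‖⁻¹) :=
    ((hgm.comp measurable_snd).mul measurable_inv_norm_sub).ennreal_ofReal
  calc ∫⁻ x in ball c ρ, ∫⁻ y, ENNReal.ofReal (g y * ‖x - y‖⁻¹)
      = ∫⁻ y, ∫⁻ x in ball c ρ, ENNReal.ofReal (g y * ‖x - y‖⁻¹) :=
        lintegral_lintegral_swap (hm.comp measurable_id).aemeasurable
    _ = ∫⁻ y, ENNReal.ofReal (g y) * ∫⁻ x in ball c ρ, ENNReal.ofReal (‖x - y‖⁻¹) := by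
        refine lintegral_congr fun y => ?_
        rw [← lintegral_const_mul' _ _ ENNReal.ofReal_ne_top]
        exact lintegral_congr fun x => ENNReal.ofReal_mul (hg0 y)
    _ ≤ ∫⁻ y, ENNReal.ofReal (g y) * K := lintegral_mono fun y => mul_le_mul_right (hKb c y) _
    _ = K * ∫⁻ y, ENNReal.ofReal (g y) := by
        rw [lintegral_mul_const _ hgm.ennreal_ofReal, mul_comm]

/-- `∫ ofReal g < ∞` for an integrable `g ≥ 0`. [folklore] -/
theorem lintegral_ofReal_ne_top_of_integrable (hgi : Integrable g) (hg0 : ∀ y, 0 ≤ g y) :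
    ∫⁻ y, ENNReal.ofReal (g y) ≠ ⊤ := by
  rw [← ofReal_integral_eq_lintegral_ofReal hgi (Eventually.of_forall hg0)]
  exact ENNReal.ofReal_ne_top

/-- The potential `x ↦ ∫ g(y)/|x - y| dy` is finite for a.e. `x`. [folklore] -/
theorem ae_lintegral_potential_lt_top (hgm : Measurable g) (hgi : Integrable g) (hg0 : ∀ y, 0 ≤ g y) :
    ∀ᵐ x : Space, ∫⁻ y, ENNReal.ofReal (g y * ‖x - y‖⁻¹) < ⊤ := by
  have hm : Measurable fun x : Space => ∫⁻ y, ENNReal.ofReal (g y * ‖x - y‖⁻¹) :=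
    (((hgm.comp measurable_snd).mul measurable_inv_norm_sub).ennreal_ofReal).lintegral_prod_right'
  -- finite on every ball `B(0, n)`, hence a.e.
  have hball : ∀ n : ℕ, ∀ᵐ x : Space, x ∈ ball (0 : Space) n → ∫⁻ y, ENNReal.ofReal (g y * ‖x - y‖⁻¹) < ⊤ := by
    intro n
    obtain ⟨K, hK, hKb⟩ := exists_setLIntegral_potential_le hgm hg0 (n : ℝ)
    have hfin : ∫⁻ x in ball (0 : Space) n, ∫⁻ y, ENNReal.ofReal (g y * ‖x - y‖⁻¹) ≠ ⊤ :=
      ne_top_of_le_ne_top (ENNReal.mul_ne_top hK (lintegral_ofReal_ne_top_of_integrable hgi hg0)) (hKb 0)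
    exact (ae_restrict_iff' measurableSet_ball).1 (ae_lt_top hm hfin)
  filter_upwards [ae_all_iff.2 hball] with x hx
  obtain ⟨n, hn⟩ := exists_nat_gt ‖x‖
  exact hx n (mem_ball_zero_iff.2 hn)

/-- The potential is measurable in `x`. [folklore] -/
theorem measurable_potential (hgm : Measurable g) : Measurable fun x : Space => ∫ y, g y * ‖x - y‖⁻¹ := by
  have hF : Measurable fun q : Space × Space => g q.2 * ‖q.1 - q.2‖⁻¹ :=
    (hgm.comp measurable_snd).mul measurable_inv_norm_sub
  exact (hF.stronglyMeasurable.integral_prod_right' (ν := (volume : Measure Space))).measurable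

/-- The (Bochner) potential is dominated by the `lintegral` one: `‖∫g(y)/|x-y|dy‖ₑ ≤ ∫⁻ g(y)/|x-y|`.
[folklore] -/
theorem enorm_potential_le (hg0 : ∀ y, 0 ≤ g y) (x : Space) :
    ‖∫ y, g y * ‖x - y‖⁻¹‖ₑ ≤ ∫⁻ y, ENNReal.ofReal (g y * ‖x - y‖⁻¹) := by
  refine (enorm_integral_le_lintegral_enorm _).trans (le_of_eq (lintegral_congr fun y => ?_))
  exact Real.enorm_eq_ofReal (mul_nonneg (hg0 y) (inv_nonneg.2 (norm_nonneg _)))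

/-- The potential is non-negative. [folklore] -/
theorem potential_nonneg (hg0 : ∀ y, 0 ≤ g y) (x : Space) : 0 ≤ ∫ y, g y * ‖x - y‖⁻¹ :=
  integral_nonneg fun y => mul_nonneg (hg0 y) (inv_nonneg.2 (norm_nonneg _))

/-- **The potential of an integrable density is locally integrable** (with the uniform bound
`∫_{B(c,ρ)} |∫g(y)/|x-y|dy| dx ≤ K(ρ)∫g`). [folklore] -/
theorem exists_setLIntegral_enorm_potential_le (hgm : Measurable g) (hg0 : ∀ y, 0 ≤ g y) (ρ : ℝ) :
    ∃ K : ℝ≥0∞, K ≠ ⊤ ∧ ∀ c : Space,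
      ∫⁻ x in ball c ρ, ‖∫ y, g y * ‖x - y‖⁻¹‖ₑ ≤ K * ∫⁻ y, ENNReal.ofReal (g y) := by
  obtain ⟨K, hK, hKb⟩ := exists_setLIntegral_potential_le hgm hg0 ρ
  exact ⟨K, hK, fun c => (lintegral_mono fun x => enorm_potential_le hg0 x).trans (hKb c)⟩

/-- The potential of an integrable density is locally integrable. [folklore] -/
theorem locallyIntegrable_potential (hgm : Measurable g) (hgi : Integrable g) (hg0 : ∀ y, 0 ≤ g y) :
    LocallyIntegrable (fun x : Space => ∫ y, g y * ‖x - y‖⁻¹) := by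
  rw [locallyIntegrable_iff]
  intro k hk
  obtain ⟨ρ, hρ⟩ := hk.isBounded.subset_ball (0 : Space)
  obtain ⟨K, hK, hKb⟩ := exists_setLIntegral_enorm_potential_le hgm hg0 ρ
  refine IntegrableOn.mono_set ?_ hρ
  refine ⟨(measurable_potential hgm).aestronglyMeasurable, ?_⟩
  rw [hasFiniteIntegral_iff_enorm]
  exact lt_of_le_of_lt (hKb 0) (ENNReal.mul_lt_top hK.lt_top (lintegral_ofReal_ne_top_of_integrable hgi hg0).lt_top)

/-- `|x - y|⁻¹ = -4π Γ(y - x)` with the tree's Newtonian kernel `Γ(z) = -(4π|z|)⁻¹`. [folklore] -/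
theorem inv_norm_sub_eq_newtonKernel (x y : Space) : ‖x - y‖⁻¹ = -(4 * Real.pi) * FluidPDE.newtonKernel (y - x) := by
  rw [FluidPDE.newtonKernel_eq, norm_sub_rev, mul_inv, neg_mul_neg, ← mul_assoc,
    mul_inv_cancel₀ (by positivity : (4 : ℝ) * Real.pi ≠ 0), one_mul]

/-- **The potential solves Poisson's equation weakly**: `∫ (∫g(y)/|x-y|dy) Δφ(x) dx = -4π∫gφ` for every
`φ ∈ C²_c` (Fubini and Green's representation `∫Γ(y-x)Δφ(x)dx = φ(y)`, `Γ = -1/(4π|x|)`).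
[cite: GilbargTrudinger2001, (2.17)] -/
theorem integral_potential_mul_laplacian (hgm : Measurable g) (hgi : Integrable g) (hg0 : ∀ y, 0 ≤ g y)
    {φ : Space → ℝ} (hφ : ContDiff ℝ 2 φ) (hc : HasCompactSupport φ) :
    ∫ x, (∫ y, g y * ‖x - y‖⁻¹) * (Δ φ) x = -(4 * Real.pi) * ∫ y, g y * φ y := by
  -- a bound and a support ball for `Δφ`
  have hΔc : Continuous (Δ φ) := FluidPDE.continuous_laplacian hφ
  have hΔ0 : ∀ x, x ∉ tsupport φ → (Δ φ) x = 0 := fun x hx => FluidPDE.laplacian_eq_zero_of_notMem_tsupport hx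
  have hΔs : HasCompactSupport (Δ φ) := by
    refine hc.mono' fun x hx => ?_
    by_contra h
    exact hx (hΔ0 x h)
  obtain ⟨ρ, hρ⟩ := hc.isCompact.isBounded.subset_ball (0 : Space)
  obtain ⟨M, hM⟩ := hΔc.bounded_above_of_compact_support hΔs
  obtain ⟨K, hK, hKb⟩ := exists_setLIntegral_potential_le hgm hg0 ρ
  have hgl := lintegral_ofReal_ne_top_of_integrable hgi hg0
  -- the integrand of the double integral and its integrability
  set f : Space → Space → ℝ := fun x y => g y * ‖x - y‖⁻¹ * (Δ φ) x with hf
  have hfm : Measurable (Function.uncurry f) :=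
    ((hgm.comp measurable_snd).mul measurable_inv_norm_sub).mul (hΔc.measurable.comp measurable_fst)
  have hbound : ∀ x : Space, ‖(Δ φ) x‖ₑ ≤ (ball (0 : Space) ρ).indicator (fun _ => ENNReal.ofReal M) x := by
    intro x
    by_cases hx : x ∈ ball (0 : Space) ρ
    · rw [indicator_of_mem hx, Real.enorm_eq_ofReal_abs]
      exact ENNReal.ofReal_le_ofReal ((Real.norm_eq_abs _).symm.le.trans (hM x))
    · rw [indicator_of_notMem hx, hΔ0 x fun h => hx (hρ h), enorm_zero]
  have hfi : Integrable (Function.uncurry f) ((volume : Measure Space).prod volume) := by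
    refine ⟨hfm.aestronglyMeasurable, ?_⟩
    rw [hasFiniteIntegral_iff_enorm, lintegral_prod _ hfm.enorm.aemeasurable]
    calc ∫⁻ x, ∫⁻ y, ‖Function.uncurry f (x, y)‖ₑ
        = ∫⁻ x, ‖(Δ φ) x‖ₑ * ∫⁻ y, ENNReal.ofReal (g y * ‖x - y‖⁻¹) := by
          refine lintegral_congr fun x => ?_
          rw [← lintegral_const_mul' _ _ enorm_ne_top]
          refine lintegral_congr fun y => ?_
          simp only [Function.uncurry_apply_pair, hf]
          rw [enorm_mul, Real.enorm_eq_ofReal (mul_nonneg (hg0 y) (inv_nonneg.2 (norm_nonneg _))), mul_comm]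
      _ ≤ ∫⁻ x, (ball (0 : Space) ρ).indicator (fun _ => ENNReal.ofReal M) x *
            ∫⁻ y, ENNReal.ofReal (g y * ‖x - y‖⁻¹) := lintegral_mono fun x => mul_le_mul_left (hbound x) _
      _ = ∫⁻ x in ball (0 : Space) ρ, ENNReal.ofReal M * ∫⁻ y, ENNReal.ofReal (g y * ‖x - y‖⁻¹) := by
          rw [← lintegral_indicator measurableSet_ball]
          refine lintegral_congr fun x => ?_
          by_cases hx : x ∈ ball (0 : Space) ρ
          · simp only [indicator_of_mem hx]
          · simp only [indicator_of_notMem hx, zero_mul]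
      _ = ENNReal.ofReal M * ∫⁻ x in ball (0 : Space) ρ, ∫⁻ y, ENNReal.ofReal (g y * ‖x - y‖⁻¹) :=
          lintegral_const_mul' _ _ ENNReal.ofReal_ne_top
      _ ≤ ENNReal.ofReal M * (K * ∫⁻ y, ENNReal.ofReal (g y)) := mul_le_mul_right (hKb 0) _
      _ < ⊤ := ENNReal.mul_lt_top ENNReal.ofReal_lt_top (ENNReal.mul_lt_top hK.lt_top hgl.lt_top)
  -- Fubini and Green's representation formula
  calc ∫ x, (∫ y, g y * ‖x - y‖⁻¹) * (Δ φ) x = ∫ x, ∫ y, f x y := by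
        refine integral_congr_ae (Eventually.of_forall fun x => ?_)
        exact (integral_mul_const ((Δ φ) x) _).symm
    _ = ∫ y, ∫ x, f x y := integral_integral_swap hfi
    _ = ∫ y, g y * (-(4 * Real.pi) * φ y) := by
        refine integral_congr_ae (Eventually.of_forall fun y => ?_)
        simp only [hf]
        simp_rw [mul_assoc]
        rw [integral_const_mul]
        congr 1
        simp_rw [inv_norm_sub_eq_newtonKernel _ y, mul_assoc]
        rw [integral_const_mul, FluidPDE.integral_newtonKernel_mul_laplacian hφ hc y]
    _ = -(4 * Real.pi) * ∫ y, g y * φ y := by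
        rw [← integral_const_mul]
        exact integral_congr_ae (Eventually.of_forall fun y => by simp only; ring)

/-- `∫ Δφ = 0` for `φ ∈ C²_c`. [folklore] -/
theorem integral_laplacian_eq_zero {φ : Space → ℝ} (hφ : ContDiff ℝ 2 φ) (hc : HasCompactSupport φ) :
    ∫ x, (Δ φ) x = 0 := by
  set b := stdOrthonormalBasis ℝ Space
  have h1 : (Δ φ) = fun x => ∑ i, fderiv ℝ (fun y => fderiv ℝ φ y (b i)) x (b i) :=
    funext fun x => FluidPDE.laplacian_eq_sum_fderiv_fderiv b hφ x
  have hC1 : ∀ i, ContDiff ℝ 1 fun y => fderiv ℝ φ y (b i) := fun i =>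
    (hφ.fderiv_right (m := 1) le_rfl).clm_apply contDiff_const
  have hcs : ∀ i, HasCompactSupport fun y => fderiv ℝ φ y (b i) := fun i => hc.fderiv_apply (𝕜 := ℝ) (b i)
  have hint : ∀ i, Integrable fun x => fderiv ℝ (fun y => fderiv ℝ φ y (b i)) x (b i) := fun i =>
    (((hC1 i).continuous_fderiv one_ne_zero).clm_apply continuous_const).integrable_of_hasCompactSupport
      ((hcs i).fderiv_apply (𝕜 := ℝ) (b i))
  rw [h1, integral_finsetSum _ fun i _ => hint i]
  exact Finset.sum_eq_zero fun i _ => FluidPDE.integral_fderiv_apply_eq_zero (hC1 i) (hcs i) (b i)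

end Potential

/-! ### The scattering solution solves Poisson's equation weakly -/

section Scattering

variable {v : ℝ → ℝ≥0∞} {ω : Space → ℝ}

/-- `g = v(1-ω) ≥ 0` (real version). [cite: Fournais2020, (A.4)] -/
theorem scatteringDensity_nonneg (hω : IsScatteringSolution v ω) (y : Space) :
    0 ≤ (v ‖y‖).toReal * (1 - ω y) :=
  mul_nonneg ENNReal.toReal_nonneg (by linarith [hω.le_one y])

/-- `g = v(1-ω)` is measurable. [cite: Fournais2020, (A.4)] -/
theorem measurable_scatteringDensity (hv : Measurable v) (hω : IsScatteringSolution v ω) :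
    Measurable fun y : Space => (v ‖y‖).toReal * (1 - ω y) :=
  ((hv.comp measurable_norm).ennreal_toReal).mul (measurable_const.sub hω.measurable)

/-- `g = v(1-ω)` is integrable when `∫v < ∞` (`0 ≤ 1 - ω ≤ 1`). [cite: Fournais2020, (A.4)] -/
theorem integrable_scatteringDensity (hv : Measurable v) (hvi : (∫⁻ x : Space, v ‖x‖) ≠ ⊤)
    (hω : IsScatteringSolution v ω) : Integrable fun y : Space => (v ‖y‖).toReal * (1 - ω y) := by
  have h1 : Integrable fun y : Space => (v ‖y‖).toReal :=
    integrable_toReal_of_lintegral_ne_top (hv.comp measurable_norm).aemeasurable hvi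
  refine h1.mono (measurable_scatteringDensity hv hω).aestronglyMeasurable (Eventually.of_forall fun y => ?_)
  rw [Real.norm_of_nonneg (scatteringDensity_nonneg hω y), Real.norm_of_nonneg ENNReal.toReal_nonneg]
  exact mul_le_of_le_one_right ENNReal.toReal_nonneg (by linarith [hω.nonneg y])

/-- **`∫ ωΔφ = -½∫gφ`** for `φ ∈ C_c^∞`: the scattering equation `∫(1-ω)Δφ = ½∫v(1-ω)φ` (A.1) and
`∫Δφ = 0`. [cite: Fournais2020, App. A (A.1)] -/
theorem integral_omega_mul_laplacian (hω : IsScatteringSolution v ω) {φ : Space → ℝ} (hφ : ContDiff ℝ (⊤ : ℕ∞) φ) (hc : HasCompactSupport φ) :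
    ∫ x, ω x * (Δ φ) x = -(2⁻¹ * ∫ x, (v ‖x‖).toReal * (1 - ω x) * φ x) := by
  have hφ2 : ContDiff ℝ 2 φ := contDiff_infty.1 hφ 2
  have hweak := hω.weak_eq φ hφ hc
  have hΔc : Continuous (Δ φ) := FluidPDE.continuous_laplacian hφ2
  have hΔs : HasCompactSupport (Δ φ) := by
    refine hc.mono' fun x hx => ?_
    by_contra h
    exact hx (FluidPDE.laplacian_eq_zero_of_notMem_tsupport h)
  have hΔi : Integrable (Δ φ) := hΔc.integrable_of_hasCompactSupport hΔs
  have hωΔ : Integrable fun x => ω x * (Δ φ) x := by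
    refine hΔi.bdd_mul (c := 1) hω.measurable.aestronglyMeasurable (Eventually.of_forall fun x => ?_)
    rw [Real.norm_of_nonneg (hω.nonneg x)]
    exact hω.le_one x
  have hsplit : ∫ x, (1 - ω x) * (Δ φ) x = (∫ x, (Δ φ) x) - ∫ x, ω x * (Δ φ) x := by
    rw [← integral_sub hΔi hωΔ]
    exact integral_congr_ae (Eventually.of_forall fun x => by simp only; ring)
  rw [hsplit, integral_laplacian_eq_zero hφ2 hc, zero_sub] at hweak
  linarith

end Scattering

/-! ### Uniqueness: the scattering solution is the Newtonian potential of `g/2` -/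

section Uniqueness

variable {v : ℝ → ℝ≥0∞} {ω : Space → ℝ}

/-- **`ω = (8π)⁻¹∫g(y)/|x-y|dy` almost everywhere** (`g = v(1-ω)`), for every scattering solution in
the sense of `IsScatteringSolution` of a finite-range potential with `∫v < ∞`: `ω` and the
Newtonian potential of `g/2` both solve `-Δu = g/2` in `𝒟'(ℝ³)` (App. A (A.1) and Green's
representation formula), so their difference `h` is a locally integrable weakly harmonic function;
its mollifications are bounded harmonic functions, hence constant (Liouville), and converge to `h`
a.e.; the constant vanishes because `ω = a/|x|` off the support (A.3) and the potential is `O(1/|x|)`.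
This is the representation `ω̂(k) = ĝ(k)/(2k²)` of [Fournais2020, (A.6)] in position space.
[cite: Fournais2020, App. A (A.1)–(A.6)] -/
theorem IsScatteringSolution.ae_eq_potential (hv : IsRepulsiveFiniteRange v)
    (hvi : (∫⁻ x : Space, v ‖x‖) ≠ ⊤) (hω : IsScatteringSolution v ω) :
    ∀ᵐ x : Space, ω x = (8 * Real.pi)⁻¹ * ∫ y, (v ‖y‖).toReal * (1 - ω y) * ‖x - y‖⁻¹ := by
  obtain ⟨hvm, R₀, hR₀⟩ := hv
  -- the density `g`, its potential `P` and the difference `h`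
  set g : Space → ℝ := fun y => (v ‖y‖).toReal * (1 - ω y) with hgdef
  have hgm : Measurable g := measurable_scatteringDensity hvm hω
  have hgi : Integrable g := integrable_scatteringDensity hvm hvi hω
  have hg0 : ∀ y, 0 ≤ g y := scatteringDensity_nonneg hω
  set R : ℝ := max R₀ 0 with hRdef
  have hR0 : 0 ≤ R := le_max_right _ _
  have hvR : ∀ r, R < r → v r = 0 := fun r hr => hR₀ r (lt_of_le_of_lt (le_max_left _ _) hr)
  have hgR : ∀ y : Space, R < ‖y‖ → g y = 0 := fun y hy => by
    simp only [hgdef, hvR _ hy, ENNReal.toReal_zero, zero_mul]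
  set P : Space → ℝ := fun x => ∫ y, g y * ‖x - y‖⁻¹ with hPdef
  have hP0 : ∀ x, 0 ≤ P x := potential_nonneg hg0
  have hPm : Measurable P := measurable_potential hgm
  have hPl : LocallyIntegrable P := locallyIntegrable_potential hgm hgi hg0
  set C : ℝ := (8 * Real.pi)⁻¹ with hCdef
  have hC0 : 0 ≤ C := by positivity
  set h : Space → ℝ := fun x => ω x - C * P x with hhdef
  have hωtop : MemLp ω ⊤ (volume : Measure Space) :=
    memLp_top_of_bound hω.measurable.aestronglyMeasurable 1 (Eventually.of_forall fun x => by
      rw [Real.norm_of_nonneg (hω.nonneg x)]; exact hω.le_one x)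
  have hωl : LocallyIntegrable ω := hωtop.locallyIntegrable le_top
  have hhl : LocallyIntegrable h := hωl.sub (hPl.smul C)
  have hhm : Measurable h := hω.measurable.sub (measurable_const.mul hPm)
  have hglint := lintegral_ofReal_ne_top_of_integrable hgi hg0
  -- (1) `h` is weakly harmonic
  have hharm : ∀ θ : Space → ℝ, ContDiff ℝ (⊤ : ℕ∞) θ → HasCompactSupport θ → ∫ x, (Δ θ) x * h x = 0 := by
    intro θ hθ hθc
    have hθ2 : ContDiff ℝ 2 θ := contDiff_infty.1 hθ 2
    have hΔc : Continuous (Δ θ) := FluidPDE.continuous_laplacian hθ2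
    have hΔs : HasCompactSupport (Δ θ) := by
      refine hθc.mono' fun x hx => ?_
      by_contra h'
      exact hx (FluidPDE.laplacian_eq_zero_of_notMem_tsupport h')
    have e1 := integral_omega_mul_laplacian hω hθ hθc
    have e2 := integral_potential_mul_laplacian hgm hgi hg0 hθ2 hθc
    have hiω : Integrable fun x => (Δ θ) x * ω x :=
      hωl.integrable_smul_left_of_hasCompactSupport hΔc hΔs
    have hiP : Integrable fun x => (Δ θ) x * P x :=
      hPl.integrable_smul_left_of_hasCompactSupport hΔc hΔs
    have hsplit : ∫ x, (Δ θ) x * h x = (∫ x, ω x * (Δ θ) x) - C * ∫ x, P x * (Δ θ) x := by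
      rw [← integral_const_mul, ← integral_sub]
      · exact integral_congr_ae (Eventually.of_forall fun x => by simp only [hhdef]; ring)
      · exact hiω.congr (Eventually.of_forall fun x => by simp only; ring)
      · exact (hiP.const_mul C).congr (Eventually.of_forall fun x => by simp only; ring)
    have e1' : ∫ x, ω x * (Δ θ) x = -(2⁻¹ * ∫ x, g x * θ x) := by
      rw [e1]
    rw [hsplit, e1', e2, hCdef]
    have hpi : Real.pi ≠ 0 := Real.pi_pos.ne'
    field_simp
    ring
  -- (2) a uniform bound for the mollifications of `h`
  have hbound : ∀ ψ : ContDiffBump (0 : Space), ∃ M : ℝ, ∀ x,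
      |(ψ.normed volume ⋆[ContinuousLinearMap.lsmul ℝ ℝ, volume] h) x| ≤ M := by
    intro ψ
    set η : Space → ℝ := ψ.normed volume with hη
    obtain ⟨B, hB⟩ := (ψ.contDiff_normed (μ := (volume : Measure Space)) (n := 0)).continuous.bounded_above_of_compact_support
      (ψ.hasCompactSupport_normed (μ := (volume : Measure Space)))
    have hB0 : 0 ≤ B := (norm_nonneg _).trans (hB 0)
    obtain ⟨K, hK, hKb⟩ := exists_setLIntegral_enorm_potential_le hgm hg0 ψ.rOut
    set M : ℝ≥0∞ := ENNReal.ofReal B * (volume (ball (0 : Space) ψ.rOut) + ENNReal.ofReal C *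
      (K * ∫⁻ y, ENNReal.ofReal (g y))) with hMdef
    have hMtop : M ≠ ⊤ := ENNReal.mul_ne_top ENNReal.ofReal_ne_top (ENNReal.add_ne_top.2
      ⟨measure_ball_lt_top.ne, ENNReal.mul_ne_top ENNReal.ofReal_ne_top (ENNReal.mul_ne_top hK hglint)⟩)
    refine ⟨M.toReal, fun x => ?_⟩
    -- pointwise bound of the integrand of the convolution
    have hηb : ∀ t, ‖η t‖ₑ ≤ (ball (0 : Space) ψ.rOut).indicator (fun _ => ENNReal.ofReal B) t := by
      intro t
      by_cases ht : t ∈ ball (0 : Space) ψ.rOut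
      · rw [indicator_of_mem ht]
        rw [← ofReal_norm]
        exact ENNReal.ofReal_le_ofReal (hB t)
      · rw [indicator_of_notMem ht]
        have : η t = 0 := by
          have h1 : t ∉ Function.support η := by rw [hη, ContDiffBump.support_normed_eq]; exact ht
          simpa [Function.mem_support] using h1
        rw [this, enorm_zero]
    have hhb : ∀ z, ‖h z‖ₑ ≤ 1 + ENNReal.ofReal C * ‖P z‖ₑ := by
      intro z
      calc ‖h z‖ₑ = ‖ω z - C * P z‖ₑ := rfl
        _ ≤ ‖ω z‖ₑ + ‖C * P z‖ₑ := enorm_sub_le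
        _ ≤ 1 + ENNReal.ofReal C * ‖P z‖ₑ := by
            gcongr
            · rw [← ofReal_norm, Real.norm_of_nonneg (hω.nonneg z), ← ENNReal.ofReal_one]
              exact ENNReal.ofReal_le_ofReal (hω.le_one z)
            · rw [enorm_mul, Real.enorm_eq_ofReal hC0]
    have hconv : ‖(η ⋆[ContinuousLinearMap.lsmul ℝ ℝ, volume] h) x‖ₑ ≤ M := by
      rw [convolution_def]
      refine (enorm_integral_le_lintegral_enorm _).trans ?_
      calc ∫⁻ t, ‖(ContinuousLinearMap.lsmul ℝ ℝ (η t)) (h (x - t))‖ₑ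
          = ∫⁻ t, ‖η t‖ₑ * ‖h (x - t)‖ₑ := by
            refine lintegral_congr fun t => ?_
            rw [ContinuousLinearMap.lsmul_apply, smul_eq_mul, enorm_mul]
        _ ≤ ∫⁻ t, (ball (0 : Space) ψ.rOut).indicator (fun _ => ENNReal.ofReal B) t *
              (1 + ENNReal.ofReal C * ‖P (x - t)‖ₑ) := lintegral_mono fun t => mul_le_mul' (hηb t) (hhb _)
        _ = ENNReal.ofReal B * ∫⁻ t in ball (0 : Space) ψ.rOut, (1 + ENNReal.ofReal C * ‖P (x - t)‖ₑ) := by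
            rw [← lintegral_indicator measurableSet_ball, ← lintegral_const_mul' _ _ ENNReal.ofReal_ne_top]
            refine lintegral_congr fun t => ?_
            by_cases ht : t ∈ ball (0 : Space) ψ.rOut
            · simp only [indicator_of_mem ht]
            · simp only [indicator_of_notMem ht, zero_mul, mul_zero]
        _ = ENNReal.ofReal B * (volume (ball (0 : Space) ψ.rOut) +
              ENNReal.ofReal C * ∫⁻ t in ball (0 : Space) ψ.rOut, ‖P (x - t)‖ₑ) := by
            rw [lintegral_add_left measurable_const, setLIntegral_const, one_mul,
              lintegral_const_mul' _ _ ENNReal.ofReal_ne_top]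
        _ ≤ M := by
            rw [hMdef]
            gcongr
            -- `∫_{B(0,r)} |P(x - t)| dt = ∫_{B(x,r)} |P| ≤ K ∫g`
            have htr : ∫⁻ t in ball (0 : Space) ψ.rOut, ‖P (x - t)‖ₑ = ∫⁻ z in ball x ψ.rOut, ‖P z‖ₑ := by
              rw [← lintegral_indicator measurableSet_ball, ← lintegral_indicator measurableSet_ball,
                ← lintegral_sub_left_eq_self (μ := (volume : Measure Space))
                  ((ball x ψ.rOut).indicator fun z => ‖P z‖ₑ) x]
              refine lintegral_congr fun t => ?_
              simp only [indicator, mem_ball, dist_eq_norm, sub_zero]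
              have : ‖x - t - x‖ = ‖t‖ := by rw [sub_sub_cancel_left, norm_neg]
              rw [this]
            rw [htr]
            exact hKb x
    have hfin : ‖(η ⋆[ContinuousLinearMap.lsmul ℝ ℝ, volume] h) x‖ₑ ≠ ⊤ := ne_top_of_le_ne_top hMtop hconv
    rw [← Real.norm_eq_abs]
    rw [← ofReal_norm] at hconv
    exact (ENNReal.ofReal_le_iff_le_toReal hMtop).1 hconv
  -- (3) the mollifications are constant
  obtain ⟨φ, hφ0, hφ2⟩ := FunctionSpaces.exists_contDiffBump_seq (E := Space)
  have hconst : ∀ (k : ℕ) (x : Space),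
      ((φ k).normed volume ⋆[ContinuousLinearMap.lsmul ℝ ℝ, volume] h) x =
        ((φ k).normed volume ⋆[ContinuousLinearMap.lsmul ℝ ℝ, volume] h) 0 := by
    intro k
    set ψ : Space → ℝ := (φ k).normed volume with hψ_def
    have hψ : FunctionSpaces.IsTestFunctionOn (⊤ : Opens Space) ψ := FunctionSpaces.isTestFunctionOn_normed (φ k)
    have hψ2 : ContDiff ℝ 2 ψ := contDiff_infty.1 hψ.contDiff 2
    have hh2 : ContDiff ℝ 2 (ψ ⋆[ContinuousLinearMap.lsmul ℝ ℝ, volume] h) :=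
      hψ.hasCompactSupport.contDiff_convolution_left _ hψ2 hhl
    have hΔ : ∀ x, Δ (ψ ⋆[ContinuousLinearMap.lsmul ℝ ℝ, volume] h) x = 0 := by
      intro x
      rw [FluidPDE.laplacian_convolution_lsmul hψ2 hψ.hasCompactSupport hhl x, convolution_def]
      simp only [ContinuousLinearMap.lsmul_apply, smul_eq_mul]
      have e := integral_sub_left_eq_self (fun t => (Δ ψ) t * h (x - t)) volume x
      simp only [sub_sub_cancel] at e
      rw [← e]
      have hθ := hψ.comp_sub_left x
      have key := hharm _ hθ.contDiff hθ.hasCompactSupport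
      simp_rw [FluidPDE.laplacian_comp_sub_left hψ2 x] at key
      exact key
    have hharm' : InnerProductSpace.HarmonicOnNhd (ψ ⋆[ContinuousLinearMap.lsmul ℝ ℝ, volume] h) univ := fun x _ =>
      ⟨hh2.contDiffAt, Eventually.of_forall fun y => hΔ y⟩
    obtain ⟨M, hM⟩ := hbound (φ k)
    exact fun x => hharm'.apply_eq_apply_of_abs_le hM x 0
  -- (4) `h` is a.e. equal to a constant `c`
  have hlim := FunctionSpaces.ae_tendsto_normed_convolution hφ0 hφ2 hhl
  set c : ℝ := limUnder atTop fun k => ((φ k).normed volume ⋆[ContinuousLinearMap.lsmul ℝ ℝ, volume] h) 0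
    with hcdef
  have hae : ∀ᵐ x : Space, h x = c := by
    filter_upwards [hlim] with x hx
    simp_rw [hconst] at hx
    exact (hx.limUnder_eq).symm
  -- (5) the constant vanishes: `∫_{B(x₀,1)}|h| = |c||B₁|` is small for `|x₀|` large
  have hc0 : c = 0 := by
    set a : ℝ := (scatteringLength v).toReal with hadef
    have ha0 : 0 ≤ a := ENNReal.toReal_nonneg
    set G : ℝ≥0∞ := ∫⁻ y, ENNReal.ofReal (g y) with hGdef
    have hGt : G ≠ ⊤ := hglint
    obtain ⟨e, he⟩ : ∃ e : Space, ‖e‖ = 1 := exists_norm_eq Space zero_le_one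
    have hkey : ∀ n : ℕ, |c| ≤ (a + C * G.toReal) * (1 / ((n : ℝ) + 1)) := by
      intro n
      set x₀ : Space := ((n : ℝ) + R + 2) • e with hx₀def
      have hx₀ : ‖x₀‖ = n + R + 2 := by
        rw [hx₀def, norm_smul, he, mul_one, Real.norm_of_nonneg (by positivity)]
      set V : ℝ≥0∞ := volume (ball x₀ 1) with hVdef
      have hVpos : V ≠ 0 := (measure_ball_pos volume x₀ one_pos).ne'
      have hVtop : V ≠ ⊤ := measure_ball_lt_top.ne
      have hzfar : ∀ z ∈ ball x₀ 1, (n : ℝ) + R + 1 < ‖z‖ := by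
        intro z hz
        rw [mem_ball, dist_eq_norm] at hz
        have := norm_sub_norm_le x₀ z
        rw [norm_sub_rev] at this
        linarith
      -- lower bound: `∫_{B(x₀,1)} |h| = |c| |B|`
      have hlow : ∫⁻ z in ball x₀ 1, ‖h z‖ₑ = ‖c‖ₑ * V := by
        have h1 : ∀ᵐ z ∂(volume.restrict (ball x₀ 1)), ‖h z‖ₑ = ‖c‖ₑ :=
          ae_restrict_of_ae (hae.mono fun z hz => by rw [hz])
        rw [lintegral_congr_ae h1, setLIntegral_const]
      -- upper bound, `ω` part
      have hωb : ∀ z ∈ ball x₀ 1, ‖ω z‖ₑ ≤ ENNReal.ofReal (a * (1 / ((n : ℝ) + 1))) := by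
        intro z hz
        have hz' := hzfar z hz
        have hzR : R₀ < ‖z‖ := by linarith [le_max_left R₀ 0]
        have hzpos : 0 < ‖z‖ := by linarith
        rw [hω.eq_div R₀ hR₀ z hzR, ← hadef, Real.enorm_eq_ofReal (div_nonneg ha0 (norm_nonneg _))]
        refine ENNReal.ofReal_le_ofReal ?_
        rw [mul_one_div]
        exact div_le_div_of_nonneg_left ha0 (by positivity) (by linarith)
      have hup2 : ∫⁻ z in ball x₀ 1, ‖ω z‖ₑ ≤ ENNReal.ofReal (a * (1 / ((n : ℝ) + 1))) * V := by
        calc ∫⁻ z in ball x₀ 1, ‖ω z‖ₑ ≤ ∫⁻ z in ball x₀ 1, ENNReal.ofReal (a * (1 / ((n : ℝ) + 1))) :=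
              setLIntegral_mono measurable_const hωb
          _ = ENNReal.ofReal (a * (1 / ((n : ℝ) + 1))) * V := setLIntegral_const _ _
      -- upper bound, potential part
      have hPb : ∀ z ∈ ball x₀ 1, ∀ y, ENNReal.ofReal (g y * ‖z - y‖⁻¹) ≤
          ENNReal.ofReal (g y) * ENNReal.ofReal (1 / ((n : ℝ) + 1)) := by
        intro z hz y
        rw [← ENNReal.ofReal_mul (hg0 y)]
        by_cases hy : R < ‖y‖
        · simp [hgR y hy]
        · refine ENNReal.ofReal_le_ofReal (mul_le_mul_of_nonneg_left ?_ (hg0 y))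
          have hz' := hzfar z hz
          have hzy : (n : ℝ) + 1 ≤ ‖z - y‖ := by
            have := norm_sub_norm_le z y
            have hy' := not_lt.1 hy
            linarith
          rw [one_div]
          exact inv_anti₀ (by positivity) hzy
      have hup3 : ∫⁻ z in ball x₀ 1, ‖P z‖ₑ ≤ ENNReal.ofReal (1 / ((n : ℝ) + 1)) * G * V := by
        calc ∫⁻ z in ball x₀ 1, ‖P z‖ₑ ≤ ∫⁻ z in ball x₀ 1, ∫⁻ y, ENNReal.ofReal (g y * ‖z - y‖⁻¹) :=
              lintegral_mono fun z => enorm_potential_le hg0 z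
          _ ≤ ∫⁻ z in ball x₀ 1, ∫⁻ y, ENNReal.ofReal (g y) * ENNReal.ofReal (1 / ((n : ℝ) + 1)) :=
              setLIntegral_mono' measurableSet_ball fun z hz => lintegral_mono fun y => hPb z hz y
          _ = ∫⁻ z in ball x₀ 1, G * ENNReal.ofReal (1 / ((n : ℝ) + 1)) := by
              refine lintegral_congr fun z => ?_
              rw [lintegral_mul_const _ hgm.ennreal_ofReal]
          _ = ENNReal.ofReal (1 / ((n : ℝ) + 1)) * G * V := by
              rw [setLIntegral_const]
              ring
      -- combine and cancel `V`
      have hωPm : Measurable fun z => ‖ω z‖ₑ := hω.measurable.enorm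
      have hcomb : ‖c‖ₑ * V ≤ (ENNReal.ofReal (a * (1 / ((n : ℝ) + 1))) +
          ENNReal.ofReal C * (ENNReal.ofReal (1 / ((n : ℝ) + 1)) * G)) * V := by
        rw [← hlow]
        calc ∫⁻ z in ball x₀ 1, ‖h z‖ₑ ≤ ∫⁻ z in ball x₀ 1, (‖ω z‖ₑ + ENNReal.ofReal C * ‖P z‖ₑ) := by
              refine lintegral_mono fun z => ?_
              calc ‖h z‖ₑ = ‖ω z - C * P z‖ₑ := rfl
                _ ≤ ‖ω z‖ₑ + ‖C * P z‖ₑ := enorm_sub_le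
                _ = ‖ω z‖ₑ + ENNReal.ofReal C * ‖P z‖ₑ := by rw [enorm_mul, Real.enorm_eq_ofReal hC0]
          _ = (∫⁻ z in ball x₀ 1, ‖ω z‖ₑ) + ENNReal.ofReal C * ∫⁻ z in ball x₀ 1, ‖P z‖ₑ := by
              rw [lintegral_add_left hωPm, lintegral_const_mul' _ _ ENNReal.ofReal_ne_top]
          _ ≤ ENNReal.ofReal (a * (1 / ((n : ℝ) + 1))) * V +
                ENNReal.ofReal C * (ENNReal.ofReal (1 / ((n : ℝ) + 1)) * G * V) := add_le_add hup2 (mul_le_mul_right hup3 _)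
          _ = _ := by ring
      have hc' : ‖c‖ₑ ≤ ENNReal.ofReal (a * (1 / ((n : ℝ) + 1))) +
          ENNReal.ofReal C * (ENNReal.ofReal (1 / ((n : ℝ) + 1)) * G) :=
        (ENNReal.mul_le_mul_iff_left hVpos hVtop).1 hcomb
      rw [Real.enorm_eq_ofReal_abs] at hc'
      have heq : ENNReal.ofReal (a * (1 / ((n : ℝ) + 1))) + ENNReal.ofReal C * (ENNReal.ofReal (1 / ((n : ℝ) + 1)) * G) =
          ENNReal.ofReal ((a + C * G.toReal) * (1 / ((n : ℝ) + 1))) := by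
        nth_rewrite 1 [← ENNReal.ofReal_toReal hGt]
        rw [← ENNReal.ofReal_mul (by positivity), ← ENNReal.ofReal_mul hC0,
          ← ENNReal.ofReal_add (by positivity) (by positivity)]
        congr 1
        ring
      rw [heq] at hc'
      exact (ENNReal.ofReal_le_ofReal_iff (by positivity)).1 hc'
    have hlim0 : Tendsto (fun n : ℕ => (a + C * G.toReal) * (1 / ((n : ℝ) + 1))) atTop (𝓝 0) := by
      have := (tendsto_one_div_add_atTop_nhds_zero_nat (𝕜 := ℝ)).const_mul (a + C * G.toReal)
      rwa [mul_zero] at this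
    have habs : |c| ≤ 0 := ge_of_tendsto' hlim0 hkey
    exact abs_nonpos_iff.1 habs
  -- (6) conclusion
  filter_upwards [hae] with x hx
  rw [hc0] at hx
  have : ω x - C * P x = 0 := hx
  linarith

end Uniqueness


end Literature.MathematicalPhysics.QuantumManyBody.BoseGas

end
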